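import Summits.FinalStateConjecture.FinalStateConjecture.Theorems.LaminatedThresholdCombLemmaAdapted
import Summits.FinalStateConjecture.FinalStateConjecture.Theorems.LaminatedThresholdAdaptedCombReduction

/-!
# Crux `LaminatedThreshold` · line `heteroclinic_comb` re-typed — Stub 1 DISCHARGED

Support file for crux item stmt-FinalStateConjecture-16893 (route LaminatedThreshold, crux A), prover seat 1,
2026-08-17. `LaminatedThresholdAdaptedCombReduction.lean` (seat 0) composes the re-typed comb line by name:
`laminatedThreshold_of_adaptedComb : CombLemmaAdapted → AdaptedVacuumCombCarrier → NakedNotSettled →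
LaminatedThreshold`, where `CombLemmaAdapted` is verbatim the registered support statement `comb_lemma_adapted`
(`stub_combLemma` of `Lines/heteroclinic_comb.lean` — false as typed, `Negative.stub_combLemma_false` — plus the
axis-invariance clause `∀ t, |t| < r₀ → (T (0, t)).1 = 0`). That statement is now PROVED
(`Comb.comb_lemma_adapted`, `LaminatedThresholdCombLemmaAdapted.lean`, with its seven support files
`LaminatedThresholdComb{MonotoneZero,ConeDynamics,Interpolation,Seeds,Globalise,Sheets,LemmaAbstract}.lean`), so
the first hypothesis can be discharged: the crux `LaminatedThreshold` now follows, kernel-checked and BY NAME, from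
the two remaining (general-relativistic, open) stubs of the re-typed line alone —

* the ADAPTED VACUUM COMB CARRIER (`stub_vacuumCombCarrier` with the axis clause inserted after `1 < μ`: an
  admissible vacuum datum `d⋆` and a `C¹` Poincaré-type map `T` of a Banach space `E × ℝ` with a saddle at `0`,
  unstable manifold straightened to the `t`-axis, a chart `π` of data near `d⋆` continuous along local families,
  and at every scale two transverse `C¹` seed hypersurfaces whose comb trichotomy forces a VISIBLE INCOMPLETE NULL
  RAY in every MGHD of the member), and
* NAKED ⇒ NOT SETTLED (`stub_nakedNotSettled`: an MGHD of an admissible datum carrying a visible incomplete null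
  ray does not settle in the summit's sense).

This is the honest residue of the line: all of its abstract dynamics is closed; what remains is physics.
-/

-- every `Summit.FinalStateConjecture.FinalStateConjecture.…` name repeats the summit = sub-problem segment (D-0017 layout)
set_option linter.dupNamespace false

open scoped Manifold ContDiff

namespace Summit.FinalStateConjecture.FinalStateConjecture.Theorems.LaminatedThreshold

/-- **`LaminatedThreshold` from the two GR stubs of the re-typed comb line** (Stub 1 discharged by
`Comb.comb_lemma_adapted`): adapted vacuum comb carrier → (naked developments are not settled) → the crux, by
name. Registered support statement `laminatedThreshold_of_adaptedCarrier` of stmt-FinalStateConjecture-16893.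
[cite: GrebogiEtAl1983] [cite: McdonaldEtAl1985] -/
theorem laminatedThreshold_of_adaptedCarrier : (∃ (X : Type) (_ : TopologicalSpace X) (_ : ChartedSpace Literature.Geometry.Lorentzian.E3 X) (_ : IsManifold (𝓡 3) ((⊤ : ℕ∞) : WithTop ℕ∞) X) (_ : T2Space X) (_ : SecondCountableTopology X) (_ : ConnectedSpace X) (dstar : Literature.Geometry.Lorentzian.InitialDataSet (𝓡 3) X) (E : Type) (_ : NormedAddCommGroup E) (_ : NormedSpace ℝ E) (_ : CompleteSpace E) (T : E × ℝ → E × ℝ) (S : E →L[ℝ] E) (μ r₀ : ℝ) (π : Literature.Geometry.Lorentzian.InitialDataSet (𝓡 3) X → E × ℝ), dstar ∈ Literature.Geometry.Lorentzian.admissibleVacuumData X ∧ T 0 = 0 ∧ 0 < r₀ ∧ ContDiffOn ℝ 1 T (Metric.ball 0 r₀) ∧ HasFDerivAt T ((S.comp (ContinuousLinearMap.fst ℝ E ℝ)).prod (μ • ContinuousLinearMap.snd ℝ E ℝ)) 0 ∧ ‖S‖ < 1 ∧ 1 < μ ∧ (∀ t : ℝ, |t| < r₀ → (T ((0 : E),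 t)).1 = 0) ∧ π dstar = 0 ∧ (∀ F : EuclideanSpace ℝ (Fin 1) → Literature.Geometry.Lorentzian.InitialDataSet (𝓡 3) X, Literature.Geometry.Lorentzian.InitialDataSet.IsSmoothDataFamily 1 F → F 0 = dstar → (∀ c, F c ∈ Literature.Geometry.Lorentzian.admissibleVacuumData X) → (∃ C : Set X, IsCompact C ∧ ∀ c, ∀ x ∉ C, (F c).h.inner x = dstar.h.inner x ∧ (F c).k x = dstar.k x) → ∃ δ : ℝ, 0 < δ ∧ ContinuousOn (fun c ↦ π (F c)) (Metric.ball 0 δ)) ∧ ∀ r : ℝ, 0 < r → ∃ (σ₁ σ₂ ε₂ : ℝ) (G₁ G₂ : E × ℝ → ℝ), 0 < ε₂ ∧ (0 < σ₁ ∧ σ₁ < r ∧ -r < σ₂ ∧ σ₂ < 0 ∧ (∃ r' : ℝ, 0 < r' ∧ ContDiffOn ℝ 1 G₁ (Metric.ball ((0 : E), σ₁) r') ∧ ContDiffOn ℝ 1 G₂ (Metric.ball ((0 : E), σ₂) r')) ∧ G₁ ((0 : E), σ₁) = 0 ∧ fderiv ℝ G₁ ((0 : E), σ₁) ((0 : E),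 (1 : ℝ)) ≠ 0 ∧ G₂ ((0 : E), σ₂) = 0 ∧ fderiv ℝ G₂ ((0 : E), σ₂) ((0 : E), (1 : ℝ)) ≠ 0) ∧ ∀ F : EuclideanSpace ℝ (Fin 1) → Literature.Geometry.Lorentzian.InitialDataSet (𝓡 3) X, Literature.Geometry.Lorentzian.InitialDataSet.IsSmoothDataFamily 1 F → F 0 = dstar → (∀ c, F c ∈ Literature.Geometry.Lorentzian.admissibleVacuumData X) → (∃ C : Set X, IsCompact C ∧ ∀ c, ∀ x ∉ C, (F c).h.inner x = dstar.h.inner x ∧ (F c).k x = dstar.k x) → ∃ δ : ℝ, 0 < δ ∧ ∀ c ∈ Metric.ball (0 : EuclideanSpace ℝ (Fin 1)) δ, ((∀ n : ℕ, T^[n] (π (F c)) ∈ Metric.ball (0 : E × ℝ) ε₂) ∨ (∃ n : ℕ, T^[n] (π (F c)) ∈ Metric.ball ((0 : E), σ₁) ε₂ ∧ G₁ (T^[n] (π (F c))) = 0) ∨ (∃ n : ℕ, T^[n] (π (F c)) ∈ Metric.ball ((0 : E), σ₂) ε₂ ∧ G₂ (T^[n] (π (F c))) = 0)) → ∀ 𝒟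 : Literature.Geometry.Lorentzian.VacuumCauchyDevelopment (F c), 𝒟.IsMaximal → ∀ [𝒟.metric.HasLeviCivita], ∃ (γ : ℝ → 𝒟.carrier) (dom : Set ℝ), 𝒟.IsVisibleIncompleteNullRay γ dom) → (∀ (X : Type) [TopologicalSpace X] [ChartedSpace Literature.Geometry.Lorentzian.E3 X] [IsManifold (𝓡 3) ((⊤ : ℕ∞) : WithTop ℕ∞) X] [T2Space X] [SecondCountableTopology X] [ConnectedSpace X], ∀ D ∈ Literature.Geometry.Lorentzian.admissibleVacuumData X, ∀ 𝒟 : Literature.Geometry.Lorentzian.VacuumCauchyDevelopment D, 𝒟.IsMaximal → (∀ [𝒟.metric.HasLeviCivita], ∃ (γ : ℝ → 𝒟.carrier) (dom : Set ℝ), 𝒟.IsVisibleIncompleteNullRay γ dom) → ¬ Summit.FinalStateConjecture.FinalStateConjecture.Theorems.ClusterCompleteness.SettlesT2 𝒟) → Summit.FinalStateConjecture.FinalStateConjecture.Theses.LaminatedThreshold.LaminatedThreshold :=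
  laminatedThreshold_of_adaptedComb Comb.comb_lemma_adapted

end Summit.FinalStateConjecture.FinalStateConjecture.Theorems.LaminatedThreshold
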